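import Literature.NumberTheory.PAdicHodge.BdRPlusRamifiedLogEval
import HarnessLib

/-!
# Linearity, boundedness of integral series, and UNIFORM continuity in the point for the ramified `p`-adic evaluation layer

Topic `Literature/NumberTheory/PAdicHodge`; namespace `Literature.NumberTheory.PAdicHodge.AinfRam`. THEOREMS ONLY (no definition, no named fact, no
instance, no `sorry`). Sequel of `BdRPlusRamifiedLogEval` (partial sums `S_M(β, y) = Σ_{m=1}^{M} (1/m)·ι_𝒪(β_m yᵐ) ∈ B_dR⁺` of a series with numerators
`β : ℕ → 𝒪_D` at a point `y` of the ramified ring `A_inf(𝒪) = AinfRam D`, values modulo `Fil^k` in the lattices `Λ(j,k) = p^j ι(𝔸_inf) + ξ^k B_dR⁺`):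
* §1 `partialSum_add`, `partialSum_mul_left` — linearity in the numerators (`β + β′`, `c·β` for `c ∈ 𝒪_D`);
* §2 `partialSum_natCast_mul` — for INTEGRAL series (`β_m = m·γ_m`) the partial sums are `ι_𝒪(Σ γ_m yᵐ) ∈ ι_𝒪(A_inf(𝒪))`, hence bounded modulo `Fil^k` by
  ONE power `p^{−r}` (`BdRPlusRamifiedLogEval.exists_pow_mul_toBdR_eq`), independently of `M`, `y`, `γ`;
* §3 ★★ `exists_pow_mul_partialSum_add_sub_partialSum_eq` — **UNIFORM CONTINUITY IN THE POINT**: there is ONE `C = C(D, k)` such that for EVERY point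
  `y ∈ A_inf(𝒪)` (any depth, even none), every perturbation `δ ∈ (ϖ, ω_𝒪)A_inf(𝒪)` (i.e. `θ_𝒪(δ) ∈ ϖ𝒪_ℂ`), all numerators `β` and all `M`:
  **`p^C · (S_M(β, y + δ) − S_M(β, y)) ∈ ι(𝔸_inf) + ξ^k B_dR⁺`**. Proof: `((y+δ)ⁿ − yⁿ)/n = Σ_{l<n} (C(n−1,l)/(l+1))·δ^{l+1} y^{n−1−l}` (the binomial
  identity `C(n,l+1)(l+1) = n·C(n−1,l)` moves the denominator from `n` to `l+1`), and `δ^{l+1}/(l+1)` is UNIFORMLY bounded: `δ^{3e−2} ∈ (p,ξ)A_inf(𝒪)`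
  (`ϖ^e ∈ (p)`, `ω^{2e−1} ∈ (p,ξ)`), so the depth estimate `term_mem_lattice_of_pow_mem` applies to `δ` for `l ≫ 0`, while `p^{T}/(l+1) ∈ ℤ_p` for `l < T`;
* §4 `exists_pow_mul_value_sub_value_eq` — the same bound for the VALUES modulo `Fil^k` at `y` and `y + δ`.
§3 is the estimate that lets a prefactor `pᵏ′ → 0` kill the discrepancy between the three shallow level-`k′` points of the towers in the Hodge-line identity
(crux K★ `stmt-BirchSwinnertonDyer-22226`, line `kato_lever`, memo `Lines/kato-lever-K2-hne-direct-omega.md` §1, F1). Infrastructure only: BSD / K★ are not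
proved by any of this.

## References
* J.-M. Fontaine, *Le corps des périodes p-adiques*, Astérisque 223 (1994), Exp. II §1.5.3–1.5.4. [FontaineAsterisque223III]
* J.-M. Fontaine, *Formes différentielles et modules de Tate des variétés abéliennes sur les corps locaux*, Invent. Math. 65 (1982), §5. [Fontaine1982FormesDifferentielles]
* P. Colmez, *Périodes p-adiques des variétés abéliennes*, Math. Ann. 292 (1992), §2. [Colmez1992PeriodesAbeliennes]
-/

noncomputable section

open ValuativeRel Field Ideal WittVector Finset

namespace Literature.NumberTheory.PAdicHodge

namespace AinfRam

open Literature.NumberTheory.GaloisRepresentations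
open Literature.NumberTheory.GaloisRepresentations.IsNonarchimedeanLocalField
open GaloisContinuity Literature.RingTheory.FormalGroups

variable {F : Type} [Field F] [ValuativeRel F] [TopologicalSpace F] [IsNonarchimedeanLocalField F]
  [CharZero F] {p : ℕ} [Fact p.Prime] [Fact (¬ IsUnit (p : integerC F))]
  [IsAdicComplete (Ideal.span {(p : integerC F)}) (integerC F)]
  {hp : valuation F p < 1} (D : EisensteinRoot F p hp) (hθ : Function.Surjective (fontaineTheta (integerC F) p))

/-! ## §1 Linearity in the numerators -/

/-- **Additivity in the numerators**: `S_M(β + β′, y) = S_M(β, y) + S_M(β′, y)`. [cite: Fontaine1982FormesDifferentielles, §5] -/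
theorem partialSum_add (β β' : ℕ → D.Coeff) (y : AinfRam D) (M : ℕ) :
    (∑ m ∈ Finset.range M, qpToBdR (((m + 1 : ℕ) : ℚ_[p])⁻¹) * toBdR D hθ (coeffHom D (β (m + 1) + β' (m + 1)) * y ^ (m + 1))) =
      (∑ m ∈ Finset.range M, qpToBdR (((m + 1 : ℕ) : ℚ_[p])⁻¹) * toBdR D hθ (coeffHom D (β (m + 1)) * y ^ (m + 1))) +
      ∑ m ∈ Finset.range M, qpToBdR (((m + 1 : ℕ) : ℚ_[p])⁻¹) * toBdR D hθ (coeffHom D (β' (m + 1)) * y ^ (m + 1)) := by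
  rw [← Finset.sum_add_distrib]
  refine Finset.sum_congr rfl fun m _ => ?_
  rw [map_add, add_mul, map_add, mul_add]

/-- **Homogeneity in the numerators**: `S_M(c·β, y) = ι_𝒪(c)·S_M(β, y)` for `c ∈ 𝒪_D`. [cite: Fontaine1982FormesDifferentielles, §5] -/
theorem partialSum_mul_left (c : D.Coeff) (β : ℕ → D.Coeff) (y : AinfRam D) (M : ℕ) :
    (∑ m ∈ Finset.range M, qpToBdR (((m + 1 : ℕ) : ℚ_[p])⁻¹) * toBdR D hθ (coeffHom D (c * β (m + 1)) * y ^ (m + 1))) =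
      toBdR D hθ (coeffHom D c) * ∑ m ∈ Finset.range M, qpToBdR (((m + 1 : ℕ) : ℚ_[p])⁻¹) * toBdR D hθ (coeffHom D (β (m + 1)) * y ^ (m + 1)) := by
  rw [Finset.mul_sum]
  refine Finset.sum_congr rfl fun m _ => ?_
  simp only [map_mul]
  ring

/-! ## §2 Integral series -/

/-- **For an integral series (`β_m = m·γ_m`) the partial sum is `ι_𝒪(Σ γ_m yᵐ)`** — an element of `ι_𝒪(A_inf(𝒪))`.
[cite: Fontaine1982FormesDifferentielles, §5] -/
theorem partialSum_natCast_mul (γ : ℕ → D.Coeff) (y : AinfRam D) (M : ℕ) :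
    (∑ m ∈ Finset.range M, qpToBdR (((m + 1 : ℕ) : ℚ_[p])⁻¹) * toBdR D hθ (coeffHom D (((m + 1 : ℕ) : D.Coeff) * γ (m + 1)) * y ^ (m + 1))) =
      toBdR D hθ (∑ m ∈ Finset.range M, coeffHom D (γ (m + 1)) * y ^ (m + 1)) := by
  rw [map_sum]
  refine Finset.sum_congr rfl fun m _ => ?_
  have hm : ((m + 1 : ℕ) : ℚ_[p]) ≠ 0 := Nat.cast_ne_zero.2 (Nat.succ_ne_zero m)
  have h1 : qpToBdR (((m + 1 : ℕ) : ℚ_[p])⁻¹) * ((m + 1 : ℕ) : BDeRhamPlus (integerC F) p) = 1 := by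
    rw [← map_natCast (qpToBdR (F := F) (p := p)), ← map_mul, inv_mul_cancel₀ hm, map_one]
  simp only [map_mul, map_natCast]
  linear_combination (toBdR D hθ (coeffHom D (γ (m + 1))) * toBdR D hθ (y ^ (m + 1))) * h1

/-- ★ **Integral series are bounded modulo `Fil^k`, uniformly**: with `r` as in `exists_pow_mul_toBdR_eq`, `p^r·S_M(m·γ, y) ∈ ι(𝔸_inf) + ξ^k B_dR⁺` for all
`γ, y, M`. [cite: FontaineAsterisque223III, Exp. II §1.5.3] -/
theorem exists_pow_mul_partialSum_natCast_mul_eq {k r : ℕ}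
    (hr : ∀ x : AinfRam D, ∃ (a : Ainf (p := p) F) (w : BDeRhamPlus (integerC F) p),
      (p : BDeRhamPlus (integerC F) p) ^ r * toBdR D hθ x = ainfToBdR a + xiBdR ^ k * w)
    (γ : ℕ → D.Coeff) (y : AinfRam D) (M : ℕ) :
    ∃ (a : Ainf (p := p) F) (w : BDeRhamPlus (integerC F) p), (p : BDeRhamPlus (integerC F) p) ^ r *
      (∑ m ∈ Finset.range M, qpToBdR (((m + 1 : ℕ) : ℚ_[p])⁻¹) * toBdR D hθ (coeffHom D (((m + 1 : ℕ) : D.Coeff) * γ (m + 1)) * y ^ (m + 1))) =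
      ainfToBdR a + xiBdR ^ k * w := by
  rw [partialSum_natCast_mul]
  exact hr _

/-! ## §3 Uniform continuity in the point -/

/-- `δ^{3e−2} ∈ (p, ξ)A_inf(𝒪)` for `δ ∈ (ϖ, ω_𝒪)` (`ϖ^e ∈ (p)`, `ω_𝒪^{2e−1} ∈ (p,ξ)`). [cite: FarguesFontaine2018, §1.2] -/
theorem pow_mem_idealPXi_of_mem_span_varpi_omega {δ : AinfRam D} (hδ : δ ∈ Ideal.span {varpi D, omega D}) :
    δ ^ (D.e + (D.e + D.e - 1) - 1) ∈ idealPXi D := by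
  obtain ⟨s, t, rfl⟩ := Ideal.mem_span_pair.1 hδ
  refine Ideal.add_pow_add_pred_mem_of_pow_mem _ ?_ ?_
  · rw [mul_pow]
    refine Ideal.mul_mem_left _ _ ?_
    obtain ⟨c, hc⟩ := Ideal.mem_span_singleton'.1 (varpi_pow_mem_span_natCast D)
    rw [← hc]
    exact Ideal.mul_mem_left _ _ (natCast_mem_idealPXi D)
  · rw [mul_pow]
    exact Ideal.mul_mem_left _ _ (omega_pow_mem_idealPXi D)

omit [CharZero F] [Fact (¬ IsUnit (p : integerC F))] [IsAdicComplete (Ideal.span {(p : integerC F)}) (integerC F)]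
  [ValuativeRel F] [TopologicalSpace F] [IsNonarchimedeanLocalField F] in
/-- `p^T·(1/i) ∈ ℤ_p` for `0 < i < p^T` (`v_p(i) ≤ T`). [folklore] -/
private theorem exists_pow_mul_inv_natCast_eq {i T : ℕ} (hi : i ≠ 0) (hiT : i < p ^ T) :
    ∃ g : ℤ_[p], (p : ℚ_[p]) ^ T * (i : ℚ_[p])⁻¹ = (g : ℚ_[p]) := by
  have hfac : i.factorization p ≤ T := by
    by_contra h
    have h' : p ^ (T + 1) ∣ i := (Nat.Prime.pow_dvd_iff_le_factorization (Fact.out : p.Prime) hi).2 (by omega)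
    have h1 : p ^ (T + 1) ≤ i := Nat.le_of_dvd (Nat.pos_of_ne_zero hi) h'
    have h2 : p ^ T < p ^ (T + 1) := Nat.pow_lt_pow_right (Fact.out : p.Prime).one_lt (Nat.lt_succ_self T)
    omega
  obtain ⟨g, hg⟩ := exists_inv_natCast_mul_pow_eq (p := p) (q := T) (k := 0) (j := T - i.factorization p) hi (by omega)
  refine ⟨(p : ℤ_[p]) ^ (T - i.factorization p) * g, ?_⟩
  rw [Nat.sub_zero, mul_comm] at hg
  rw [hg, PadicInt.coe_mul, PadicInt.coe_pow, PadicInt.coe_natCast]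

/-- **The bounded building block of the continuity estimate**: with `r` bounding `ι_𝒪(A_inf(𝒪))` modulo `Fil^k` and `δ ∈ (ϖ, ω_𝒪)`, there is ONE
`C` with `p^C·(1/i)·ι_𝒪(δⁱ·x) ∈ ι(𝔸_inf) + ξ^k B_dR⁺` for ALL `i ≥ 1` and ALL `x ∈ A_inf(𝒪)` (large `i`: the depth estimate for `δ`; small `i`:
`p^T/i ∈ ℤ_p`). [cite: FontaineAsterisque223III, Exp. II §1.5.3] -/
theorem exists_pow_mul_inv_mul_toBdR_pow_mul_eq {k r : ℕ}
    (hr : ∀ x : AinfRam D, ∃ (a : Ainf (p := p) F) (w : BDeRhamPlus (integerC F) p),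
      (p : BDeRhamPlus (integerC F) p) ^ r * toBdR D hθ x = ainfToBdR a + xiBdR ^ k * w) :
    ∃ C : ℕ, ∀ (δ : AinfRam D), δ ∈ Ideal.span {varpi D, omega D} → ∀ (i : ℕ), i ≠ 0 → ∀ x : AinfRam D,
      ∃ (a : Ainf (p := p) F) (w : BDeRhamPlus (integerC F) p),
        (p : BDeRhamPlus (integerC F) p) ^ C * (qpToBdR ((i : ℚ_[p])⁻¹) * toBdR D hθ (δ ^ i * x)) =
          ainfToBdR ((p : Ainf (p := p) F) ^ 0 * a) + xiBdR ^ k * w := by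
  set N₀ : ℕ := D.e + (D.e + D.e - 1) - 1 with hN₀
  have hN₀1 : 1 ≤ N₀ := by have := D.e_pos; omega
  set T : ℕ := N₀ * (2 * (r + 2 * r + k + N₀)) with hT
  refine ⟨T + r, fun δ hδ i hi x => ?_⟩
  have hδN : δ ^ N₀ ∈ idealPXi D := pow_mem_idealPXi_of_mem_span_varpi_omega D hδ
  by_cases hiT : T ≤ i
  · -- large `i`: the depth estimate for `δ` gives `(1/i) ι_𝒪(δ^i) ∈ Λ(r, k)`, times the bounded `ι_𝒪(x)`
    obtain ⟨ax, wx, hx⟩ := hr x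
    obtain ⟨a, w, h⟩ := term_mem_lattice_of_pow_mem D hθ hr hN₀1 hδN (fun _ => (1 : D.Coeff)) (j := r) (m := i) hiT
    rw [map_one, one_mul] at h
    have h' : qpToBdR ((i : ℚ_[p])⁻¹) * toBdR D hθ (δ ^ i) = ainfToBdR ((p : Ainf (p := p) F) ^ (0 + r) * a) + xiBdR ^ k * w := by
      rw [zero_add]; exact h
    obtain ⟨a', w', h2⟩ := lattice_mul_of_bounded hx h'
    refine ⟨(p : Ainf (p := p) F) ^ (T + r) * a', (p : BDeRhamPlus (integerC F) p) ^ (T + r) * w', ?_⟩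
    have e : (p : BDeRhamPlus (integerC F) p) ^ (T + r) * (qpToBdR ((i : ℚ_[p])⁻¹) * toBdR D hθ (δ ^ i * x)) =
        (p : BDeRhamPlus (integerC F) p) ^ (T + r) * (toBdR D hθ x * (qpToBdR ((i : ℚ_[p])⁻¹) * toBdR D hθ (δ ^ i))) := by
      rw [map_mul]; ring
    rw [e, h2]
    simp only [map_mul, map_pow, map_natCast, pow_zero, one_mul]
    ring
  · -- small `i`: `p^T / i ∈ ℤ_p`
    obtain ⟨ax, wx, hx⟩ := hr (δ ^ i * x)
    have hiT' : i < p ^ T := lt_of_lt_of_le (not_le.1 hiT) (Nat.lt_pow_self (Fact.out : p.Prime).one_lt).le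
    obtain ⟨g, hg⟩ := exists_pow_mul_inv_natCast_eq (p := p) hi hiT'
    have hq : (p : BDeRhamPlus (integerC F) p) ^ T * qpToBdR ((i : ℚ_[p])⁻¹) = ainfToBdR (zpToAinf g) := by
      rw [← map_natCast (qpToBdR (F := F) (p := p)) p, ← map_pow, ← map_mul, hg, qpToBdR_coe]
    refine ⟨zpToAinf g * ax, ainfToBdR (zpToAinf g) * wx, ?_⟩
    have e1 : (p : BDeRhamPlus (integerC F) p) ^ (T + r) * (qpToBdR ((i : ℚ_[p])⁻¹) * toBdR D hθ (δ ^ i * x)) =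
        ((p : BDeRhamPlus (integerC F) p) ^ T * qpToBdR ((i : ℚ_[p])⁻¹)) * ((p : BDeRhamPlus (integerC F) p) ^ r * toBdR D hθ (δ ^ i * x)) := by
      rw [pow_add]; ring
    rw [e1, hq, hx]
    simp only [map_mul, pow_zero, one_mul]
    ring

/-- The binomial rearrangement `((y+δ)^{m+1} − y^{m+1})/(m+1) = Σ_{l ≤ m} (1/(l+1))·δ^{l+1}·(C(m,l)·y^{m−l})`, with a numerator `c`, read in `B_dR⁺`.
[cite: Fontaine1982FormesDifferentielles, §5] -/
theorem inv_mul_toBdR_mul_add_pow_sub_pow (c y δ : AinfRam D) (m : ℕ) :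
    qpToBdR (((m + 1 : ℕ) : ℚ_[p])⁻¹) * toBdR D hθ (c * ((y + δ) ^ (m + 1) - y ^ (m + 1))) =
      ∑ l ∈ Finset.range (m + 1), qpToBdR (((l + 1 : ℕ) : ℚ_[p])⁻¹) * toBdR D hθ (δ ^ (l + 1) * (c * (m.choose l : AinfRam D) * y ^ (m - l))) := by
  have hexp : (y + δ) ^ (m + 1) - y ^ (m + 1) = ∑ l ∈ Finset.range (m + 1), δ ^ (l + 1) * y ^ (m - l) * ((m + 1).choose (l + 1) : AinfRam D) := by
    rw [add_comm y δ, add_pow, Finset.sum_range_succ']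
    simp only [pow_zero, Nat.sub_zero, Nat.choose_zero_right, Nat.cast_one, mul_one, one_mul, add_sub_cancel_right]
    refine Finset.sum_congr rfl fun l hl => ?_
    rw [show m + 1 - (l + 1) = m - l by omega]
  rw [hexp, Finset.mul_sum, map_sum, Finset.mul_sum]
  refine Finset.sum_congr rfl fun l _ => ?_
  have hm : ((m + 1 : ℕ) : ℚ_[p]) ≠ 0 := Nat.cast_ne_zero.2 (Nat.succ_ne_zero m)
  have hl : ((l + 1 : ℕ) : ℚ_[p]) ≠ 0 := Nat.cast_ne_zero.2 (Nat.succ_ne_zero l)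
  have hchoose : ((m + 1 : ℕ) : ℚ_[p]) * (m.choose l : ℚ_[p]) = ((m + 1).choose (l + 1) : ℚ_[p]) * ((l + 1 : ℕ) : ℚ_[p]) := by
    exact_mod_cast Nat.add_one_mul_choose_eq m l
  have hq : (((m + 1 : ℕ) : ℚ_[p])⁻¹) * ((m + 1).choose (l + 1) : ℚ_[p]) = (((l + 1 : ℕ) : ℚ_[p])⁻¹) * (m.choose l : ℚ_[p]) := by
    have h1 : ((m + 1).choose (l + 1) : ℚ_[p]) = ((m + 1 : ℕ) : ℚ_[p]) * (m.choose l : ℚ_[p]) * ((l + 1 : ℕ) : ℚ_[p])⁻¹ := by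
      rw [eq_mul_inv_iff_mul_eq₀ hl, hchoose]
    rw [h1, ← mul_assoc, ← mul_assoc, inv_mul_cancel₀ hm, one_mul, mul_comm]
  have e1 : toBdR D hθ (c * (δ ^ (l + 1) * y ^ (m - l) * ((m + 1).choose (l + 1) : AinfRam D))) =
      qpToBdR (((m + 1).choose (l + 1) : ℚ_[p])) * toBdR D hθ (c * δ ^ (l + 1) * y ^ (m - l)) := by
    simp only [map_mul, map_natCast]; ring
  have e2 : toBdR D hθ (δ ^ (l + 1) * (c * (m.choose l : AinfRam D) * y ^ (m - l))) =
      qpToBdR ((m.choose l : ℚ_[p])) * toBdR D hθ (c * δ ^ (l + 1) * y ^ (m - l)) := by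
    simp only [map_mul, map_natCast]; ring
  rw [e1, e2, ← mul_assoc, ← mul_assoc, ← map_mul, ← map_mul, hq]

/-- ★★ **Uniform continuity of the partial sums in the point.** With `r` bounding `ι_𝒪(A_inf(𝒪))` modulo `Fil^k` there is ONE `C = C(D, k, r)` such that for ALL
numerators `β : ℕ → 𝒪_D`, ALL points `y ∈ A_inf(𝒪)`, ALL `δ ∈ (ϖ, ω_𝒪)A_inf(𝒪)` and ALL `M`:
**`p^C · (S_M(β, y + δ) − S_M(β, y)) ∈ ι(𝔸_inf) + ξ^k B_dR⁺`.** [cite: FontaineAsterisque223III, Exp. II §1.5.3] [cite: Colmez1992PeriodesAbeliennes, §2] -/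
theorem exists_pow_mul_partialSum_add_sub_partialSum_eq {k r : ℕ}
    (hr : ∀ x : AinfRam D, ∃ (a : Ainf (p := p) F) (w : BDeRhamPlus (integerC F) p),
      (p : BDeRhamPlus (integerC F) p) ^ r * toBdR D hθ x = ainfToBdR a + xiBdR ^ k * w) :
    ∃ C : ℕ, ∀ (β : ℕ → D.Coeff) (y δ : AinfRam D), δ ∈ Ideal.span {varpi D, omega D} → ∀ M : ℕ,
      ∃ (a : Ainf (p := p) F) (w : BDeRhamPlus (integerC F) p), (p : BDeRhamPlus (integerC F) p) ^ C *
        ((∑ m ∈ Finset.range M, qpToBdR (((m + 1 : ℕ) : ℚ_[p])⁻¹) * toBdR D hθ (coeffHom D (β (m + 1)) * (y + δ) ^ (m + 1))) -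
          ∑ m ∈ Finset.range M, qpToBdR (((m + 1 : ℕ) : ℚ_[p])⁻¹) * toBdR D hθ (coeffHom D (β (m + 1)) * y ^ (m + 1))) =
        ainfToBdR a + xiBdR ^ k * w := by
  obtain ⟨C, hC⟩ := exists_pow_mul_inv_mul_toBdR_pow_mul_eq D hθ hr
  refine ⟨C, fun β y δ hδ M => ?_⟩
  rw [← Finset.sum_sub_distrib, Finset.mul_sum]
  have hterm : ∀ m ∈ Finset.range M, ∃ (a : Ainf (p := p) F) (w : BDeRhamPlus (integerC F) p),
      (p : BDeRhamPlus (integerC F) p) ^ C * (qpToBdR (((m + 1 : ℕ) : ℚ_[p])⁻¹) * toBdR D hθ (coeffHom D (β (m + 1)) * (y + δ) ^ (m + 1)) -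
        qpToBdR (((m + 1 : ℕ) : ℚ_[p])⁻¹) * toBdR D hθ (coeffHom D (β (m + 1)) * y ^ (m + 1))) =
        ainfToBdR ((p : Ainf (p := p) F) ^ 0 * a) + xiBdR ^ k * w := by
    intro m _
    rw [← mul_sub, ← map_sub, ← mul_sub, inv_mul_toBdR_mul_add_pow_sub_pow, Finset.mul_sum]
    exact lattice_sum _ fun l _ => hC δ hδ (l + 1) (Nat.succ_ne_zero l) _
  obtain ⟨a, w, h⟩ := lattice_sum _ hterm
  exact ⟨a, w, by rw [h, pow_zero, one_mul]⟩

/-! ## §4 The same bound for the values -/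

/-- ★ **Uniform continuity of the VALUES in the point**: if `L` is a value modulo `Fil^k` of the series at `y` and `L′` one at `y + δ` (`δ ∈ (ϖ, ω_𝒪)`),
then `p^C·(L′ − L) ∈ ι(𝔸_inf) + ξ^k B_dR⁺` with the constant `C` of §3 (independent of `y`, `δ`, `β`). [cite: FontaineAsterisque223III, Exp. II §1.5.3] -/
theorem pow_mul_value_sub_value_mem {k C : ℕ}
    (hC : ∀ (β : ℕ → D.Coeff) (y δ : AinfRam D), δ ∈ Ideal.span {varpi D, omega D} → ∀ M : ℕ,
      ∃ (a : Ainf (p := p) F) (w : BDeRhamPlus (integerC F) p), (p : BDeRhamPlus (integerC F) p) ^ C *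
        ((∑ m ∈ Finset.range M, qpToBdR (((m + 1 : ℕ) : ℚ_[p])⁻¹) * toBdR D hθ (coeffHom D (β (m + 1)) * (y + δ) ^ (m + 1))) -
          ∑ m ∈ Finset.range M, qpToBdR (((m + 1 : ℕ) : ℚ_[p])⁻¹) * toBdR D hθ (coeffHom D (β (m + 1)) * y ^ (m + 1))) =
        ainfToBdR a + xiBdR ^ k * w)
    (β : ℕ → D.Coeff) {y δ : AinfRam D} (hδ : δ ∈ Ideal.span {varpi D, omega D}) {L L' : BDeRhamPlus (integerC F) p}
    (hL : ∀ j : ℕ, ∃ M₀ : ℕ, ∀ M : ℕ, M₀ ≤ M → ∃ (a : Ainf (p := p) F) (w : BDeRhamPlus (integerC F) p),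
      L - (∑ m ∈ Finset.range M, qpToBdR (((m + 1 : ℕ) : ℚ_[p])⁻¹) * toBdR D hθ (coeffHom D (β (m + 1)) * y ^ (m + 1))) =
        ainfToBdR ((p : Ainf (p := p) F) ^ j * a) + xiBdR ^ k * w)
    (hL' : ∀ j : ℕ, ∃ M₀ : ℕ, ∀ M : ℕ, M₀ ≤ M → ∃ (a : Ainf (p := p) F) (w : BDeRhamPlus (integerC F) p),
      L' - (∑ m ∈ Finset.range M, qpToBdR (((m + 1 : ℕ) : ℚ_[p])⁻¹) * toBdR D hθ (coeffHom D (β (m + 1)) * (y + δ) ^ (m + 1))) =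
        ainfToBdR ((p : Ainf (p := p) F) ^ j * a) + xiBdR ^ k * w) :
    ∃ (a : Ainf (p := p) F) (w : BDeRhamPlus (integerC F) p),
      (p : BDeRhamPlus (integerC F) p) ^ C * (L' - L) = ainfToBdR a + xiBdR ^ k * w := by
  obtain ⟨M₀, h⟩ := hL 0
  obtain ⟨M₀', h'⟩ := hL' 0
  obtain ⟨a₁, w₁, h1⟩ := h (max M₀ M₀') (le_max_left _ _)
  obtain ⟨a₂, w₂, h2⟩ := h' (max M₀ M₀') (le_max_right _ _)
  obtain ⟨a₃, w₃, h3⟩ := hC β y δ hδ (max M₀ M₀')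
  set S := ∑ m ∈ Finset.range (max M₀ M₀'), qpToBdR (((m + 1 : ℕ) : ℚ_[p])⁻¹) * toBdR D hθ (coeffHom D (β (m + 1)) * y ^ (m + 1)) with hS
  set S' := ∑ m ∈ Finset.range (max M₀ M₀'), qpToBdR (((m + 1 : ℕ) : ℚ_[p])⁻¹) * toBdR D hθ (coeffHom D (β (m + 1)) * (y + δ) ^ (m + 1)) with hS'
  refine ⟨(p : Ainf (p := p) F) ^ C * (a₂ - a₁) + a₃, (p : BDeRhamPlus (integerC F) p) ^ C * (w₂ - w₁) + w₃, ?_⟩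
  have e : (p : BDeRhamPlus (integerC F) p) ^ C * (L' - L) =
      (p : BDeRhamPlus (integerC F) p) ^ C * ((L' - S') - (L - S)) + (p : BDeRhamPlus (integerC F) p) ^ C * (S' - S) := by ring
  rw [e, h1, h2, h3]
  simp only [map_mul, map_add, map_sub, map_pow, map_natCast, pow_zero, one_mul]
  ring

end AinfRam

end Literature.NumberTheory.PAdicHodge

end
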